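import Literature.IUT.HodgeTheaters.PMBaseProcessions
import Literature.IUT.HodgeTheaters.PMBaseBridgePropsProofs4

/-!
# Proofs over [IUTchI] Ex 6.3 (ii) / Props 6.6 (ii), 6.8 (i): the `𝔽_l^{⋊±}`-symmetry, conditionally

Mochizuki, *Inter-universal Teichmüller theory I*, §6, Example 6.3 (ii) p. 161, Proposition 6.6 (ii)
p. 165, Proposition 6.8 (i) pp. 167–168, kurims manuscript (May 2020). PROOF-ONLY companion (theorems, no
definitions) to abc-iut-L5-t4's `PMBaseModels.lean` / `PMBaseBridgeProps.lean` / `PMBaseProcessions.lean`,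
by the L5 discharge seat abc-iut-L5-t13.

* **Ex 6.3 (ii) for POSITIVE elements — PROVED**: the equivariance `Ex63.Equivariant K γ` of the model
  `Θ^{ell}`-poly-morphisms holds for every translation `γ ∈ 𝔽_l ⊆ 𝔽_l^{⋊±}` over every base kit
  (`Ex63.equivariant_of_isPositive`) — pure group theory in `Aut_±(𝒟^{⊚±}) ⊇ Aut_csp(𝒟^{⊚±})`.
* For NEGATIVE `γ` the equivariance ("one verifies immediately that `φ^{Θell}_±` is equivariant", p. 161)
  asserts the compatibility of `φ^{Θell}_{•,v}` with a negative automorphism of `𝒟_v`; the interface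
  `PMBaseKit` does not carry it, so it enters below as the HYPOTHESIS
  `∀ γ, γ.IsNegative → Ex63.Equivariant K γ` (a verify-after-merge clause, not discharged here).
* **Prop 6.6 (ii) — PROVED conditionally**: `DThetaEllBridge.IsoTorsor B₁ B₂` for all `𝒟-Θ^{ell}`-bridges
  over a base kit with a valuation, GIVEN the negative equivariance (`DThetaEllBridge.isoTorsor_of_equivariant`);
  unconditionally: existence (`…Proofs2`), injectivity (`…Proofs4`), and surjectivity onto the POSITIVE
  index-set isomorphisms.
* **Prop 6.8 (i) — PROVED conditionally** likewise (`DThetaPMEllHT.ellBridgeSymmetry_of_equivariant`;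
  `2 < l` is forced by the finiteness of `T`).
Record only; [claim: Mochizuki2012, status: disputed]; nothing here takes a side on any disputed step.
-/

namespace Literature.IUT.HodgeTheaters

open CategoryTheory

universe u

namespace PMBaseKit

variable {l : ℕ} {K : PMBaseKit.{u} l}

/-! ### Example 6.3 (ii) for translations -/

namespace Ex63

/-- **[IUTchI] Ex 6.3 (ii), positive elements — PROVED**: `φ^{Θell}_±` is equivariant for the poly-action
of every translation `γ = (c, +1) ∈ 𝔽_l^{⋊±}` (p. 161). [claim: Mochizuki2012, status: disputed] -/
theorem equivariant_of_isPositive {γ : FlPM l} (hγ : γ.IsPositive) : Equivariant K γ := by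
  obtain ⟨c, rfl⟩ := (FlPM.isPositive_iff_exists_transl γ).mp hγ
  intro t v
  change {h | ∃ f ∈ poly K t v, ∃ b ∈ lifts K (FlPM.transl c), h = f ≫ (K.atV v).map b.hom} =
    {h | ∃ p ∈ (DStrip.model K).signedPolyAut (fun _ => (FlPM.transl c).right),
      ∃ g ∈ poly K (FlPM.transl c • t) v, h = (p v).hom ≫ g}
  rw [FlPM.transl_right, FlPM.transl_smul]
  ext h
  constructor
  · rintro ⟨f, hf, b, hb, rfl⟩
    refine ⟨DStrip.Iso.refl _, DStrip.refl_mem_signedPolyAut_one _, f ≫ (K.atV v).map b.hom,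
      by rw [poly_add t c v hb]; exact ⟨f, hf, rfl⟩, by simp [DStrip.Iso.refl]⟩
  · rintro ⟨p, hp, g, hg, rfl⟩
    have hpv : K.labMap v (p v) = Equiv.refl _ := by
      have := (DStrip.mem_signedPolyAut_iff _ _).mp hp v
      exact this.mpr rfl
    obtain ⟨b, hb⟩ := lifts_nonempty (K := K) (FlPM.transl c)
    have hmem : (p v).hom ≫ g ∈ poly K (t + c) v := pre_mem_poly hpv hg
    rw [poly_add t c v hb] at hmem
    obtain ⟨f, hf, hfeq⟩ := hmem
    exact ⟨f, hf, b, hb, hfeq⟩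

end Ex63

/-! ### The global side of the compatibility square, for an arbitrary element of `𝔽_l^{⋊±}` -/

/-- `lifts(1) = Aut_csp(𝒟^{⊚±})`. [claim: Mochizuki2012, status: disputed] -/
theorem Ex63.lifts_one : Ex63.lifts K (1 : FlPM l) = K.autCsp K.gModel := by
  rw [← Ex63.lifts_transl_zero]
  rfl

/-- Every lift of `γ` is a fixed lift followed by an element of `Aut_csp(𝒟^{⊚±})`.
[claim: Mochizuki2012, status: disputed] -/
theorem Ex63.exists_csp_of_mem_lifts {γ : FlPM l} {b b' : Aut K.gModel} (hb : b ∈ lifts K γ)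
    (hb' : b' ∈ lifts K γ) : ∃ c ∈ K.autCsp K.gModel, b' = b ≪≫ c := by
  refine ⟨b.symm ≪≫ b', ?_, by simp⟩
  have h := trans_mem_lifts (symm_mem_lifts hb) hb'
  rw [mul_inv_cancel, Ex63.lifts_one] at h
  exact h

/-- **Global side, general form.** Post-composing `ellConj a β₁ (φ^{Θell}_{v_z})` with the
`Aut_csp(‡𝒟^{⊚±})`-orbit of `β₁⁻¹ ∘ b ∘ β₂`, `b` a lift of `γ ∈ 𝔽_l^{⋊±}`, gives — GIVEN the equivariance
of Example 6.3 (ii) for `γ` — the conjugate by the sign-twisted `a` of `φ^{Θell}_{v_{γ z}}`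
([IUTchI] Ex 6.3 (ii) p. 161; Def 6.4 (ii) p. 163). [claim: Mochizuki2012, status: disputed] -/
theorem ellConj_global_side_of_equivariant {C : K.DStrip} {G₁ G₂ : K.Glob} (a : (DStrip.model K).Iso C)
    (β₁ : K.gModel ≅ G₁) (β₂ : K.gModel ≅ G₂) (z : ZMod l) (v : K.V) {γ : FlPM l}
    (hE : Ex63.Equivariant K γ) {b : Aut K.gModel} (hb : b ∈ Ex63.lifts K γ)
    {s : (DStrip.model K).Iso (DStrip.model K)} (hs : s ∈ (DStrip.model K).signedPolyAut fun _ => γ.right) :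
    {h | ∃ f ∈ K.ellConj a β₁ v (Ex63.poly K z v),
      ∃ q ∈ {ψ : G₁ ≅ G₂ | ∃ c' ∈ K.autCsp G₂, ψ = (β₁.symm ≪≫ b ≪≫ β₂) ≪≫ c'},
        h = f ≫ (K.atV v).map (q : G₁ ≅ G₂).hom} =
      K.ellConj (s.symm.trans a) β₂ v (Ex63.poly K (γ • z) v) := by
  have hEq := hE z v
  change {h | ∃ f ∈ Ex63.poly K z v, ∃ b ∈ Ex63.lifts K γ, h = f ≫ (K.atV v).map b.hom} =
    {h | ∃ p ∈ (DStrip.model K).signedPolyAut (fun _ => γ.right),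
      ∃ g ∈ Ex63.poly K (γ • z) v, h = (p v).hom ≫ g} at hEq
  ext h
  constructor
  · rintro ⟨f, ⟨f₀, hf₀, rfl⟩, q, ⟨c', hc', rfl⟩, rfl⟩
    obtain ⟨c', rfl⟩ : ∃ c'' : G₂ ≅ G₂, c'' = c' := ⟨c', rfl⟩
    have hc'' : (β₂ ≪≫ c' ≪≫ β₂.symm : Aut K.gModel) ∈ K.autCsp K.gModel := conj_mem_autCsp β₂ hc'
    -- `f₀ ≫ atV (b c'')` lies in the equivariance set, hence is `p_v ≫ g`
    have hmem : f₀ ≫ (K.atV v).map (b ≪≫ (β₂ ≪≫ c' ≪≫ β₂.symm)).hom ∈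
        {h | ∃ p ∈ (DStrip.model K).signedPolyAut (fun _ => γ.right),
          ∃ g ∈ Ex63.poly K (γ • z) v, h = (p v).hom ≫ g} := by
      rw [← hEq]
      exact ⟨f₀, hf₀, _, Ex63.trans_csp_mem_lifts hb hc'', rfl⟩
    obtain ⟨p, hp, g, hg, hpg⟩ := hmem
    -- `p = s · (positive)`
    rw [DStrip.signedPolyAut_eq_plusFullPolyIso hs] at hp
    obtain ⟨ap, hap, rfl⟩ := hp
    have hapv : K.labMap v (ap v) = Equiv.refl _ :=
      (K.mem_autPlus_iff _).mp (((DStrip.model K).mem_autPlus_iff ap).mp hap v)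
    refine ⟨(ap v).hom ≫ g, Ex63.pre_mem_poly hapv hg, ?_⟩
    change ((a v).inv ≫ f₀ ≫ (K.atV v).map β₁.hom) ≫ (K.atV v).map ((β₁.symm ≪≫ b ≪≫ β₂) ≪≫ c').hom =
      ((s v).symm ≪≫ a v).inv ≫ ((ap v).hom ≫ g) ≫ (K.atV v).map β₂.hom
    have hpg' : f₀ ≫ (K.atV v).map b.hom ≫ (K.atV v).map β₂.hom ≫ (K.atV v).map c'.hom =
        (s v).hom ≫ (ap v).hom ≫ g ≫ (K.atV v).map β₂.hom := by
      have h := congrArg (· ≫ (K.atV v).map β₂.hom) hpg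
      simpa [Functor.map_comp, Category.assoc] using h
    simp only [Iso.trans_hom, Iso.symm_hom, Functor.map_comp, Category.assoc, Iso.trans_inv, Iso.symm_inv,
      Iso.map_hom_inv_id_assoc]
    rw [hpg']
  · rintro ⟨g, hg, rfl⟩
    -- `(s v) ≫ g` lies in the equivariance set, hence is `f₀ ≫ atV b'` with `b'` a lift of `γ`
    have hmem : (s v).hom ≫ g ∈ {h | ∃ f ∈ Ex63.poly K z v, ∃ b ∈ Ex63.lifts K γ,
        h = f ≫ (K.atV v).map b.hom} := by
      rw [hEq]
      exact ⟨s, hs, g, hg, rfl⟩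
    obtain ⟨f₀, hf₀, b', hb', hfb⟩ := hmem
    obtain ⟨c, hc, rfl⟩ := Ex63.exists_csp_of_mem_lifts hb hb'
    refine ⟨(a v).inv ≫ f₀ ≫ (K.atV v).map β₁.hom, ⟨f₀, hf₀, rfl⟩,
      (β₁.symm ≪≫ b ≪≫ β₂) ≪≫ (β₂.symm ≪≫ c ≪≫ β₂), ⟨β₂.symm ≪≫ c ≪≫ β₂, ?_, rfl⟩, ?_⟩
    · show K.gLabMap (β₂.symm ≪≫ c ≪≫ β₂) = Equiv.refl _
      have hc1 : K.gLabMap c = Equiv.refl _ := MonoidHom.mem_ker.mp hc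
      rw [K.gLabMap_trans, K.gLabMap_trans, hc1, Equiv.refl_trans, ← K.gLabMap_trans, Iso.symm_self_id,
        K.gLabMap_refl]
    · change ((s v).symm ≪≫ a v).inv ≫ g ≫ (K.atV v).map β₂.hom = _
      simp only [Iso.trans_inv, Iso.symm_inv, Category.assoc, Iso.trans_hom, Iso.symm_hom, Functor.map_comp]
      rw [reassoc_of% hfb]
      simp [← Functor.map_comp]

namespace DThetaEllBridge

/-- **Construction under equivariance.** For `𝒟-Θ^{ell}`-bridges exhibited by `(ι₁, α₁, β₁)`, `(ι₂, α₂, β₂)`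
and `γ ∈ 𝔽_l^{⋊±}` whose equivariance (Ex 6.3 (ii)) holds, there is an isomorphism with index bijection
`ι₂ ∘ γ ∘ ι₁⁻¹` ([IUTchI] Prop 6.6 (ii) p. 165). [claim: Mochizuki2012, status: disputed] -/
theorem Iso.exists_of_equivariant (B₁ B₂ : K.DThetaEllBridge)
    {ι₁ : ZMod l ≃ B₁.T} (hι₁ : ∀ e ∈ B₁.torT.charts, ι₁.trans e ∈ (FlPMTorsor.tautological l).charts)
    {α₁ : ∀ z, (DStrip.model K).Iso (B₁.capsule (ι₁ z))} {β₁ : K.gModel ≅ B₁.glob}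
    (h₁ : ∀ z v, B₁.poly (ι₁ z) v = K.ellConj (α₁ z) β₁ v (Ex63.poly K z v))
    {ι₂ : ZMod l ≃ B₂.T} (hι₂ : ∀ e ∈ B₂.torT.charts, ι₂.trans e ∈ (FlPMTorsor.tautological l).charts)
    {α₂ : ∀ z, (DStrip.model K).Iso (B₂.capsule (ι₂ z))} {β₂ : K.gModel ≅ B₂.glob}
    (h₂ : ∀ z v, B₂.poly (ι₂ z) v = K.ellConj (α₂ z) β₂ v (Ex63.poly K z v))
    (γ : FlPM l) (hE : Ex63.Equivariant K γ) :
    ∃ g : Iso B₁ B₂, g.indexEquiv = ι₁.symm.trans ((FlPM.toPerm l γ).trans ι₂) := by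
  obtain ⟨b, hb⟩ := Ex63.lifts_nonempty (K := K) γ
  obtain ⟨s, hs⟩ := DStrip.exists_mem_signedPolyAut (DStrip.model K) (fun _ => γ.right)
  let α₁' : ∀ t : B₁.T, (DStrip.model K).Iso (B₁.capsule t) := fun t v =>
    α₁ (ι₁.symm t) v ≪≫ eqToIso (congrArg (fun s => (B₁.capsule s).obj v) (ι₁.apply_symm_apply t))
  have hα₁' : ∀ z, α₁' (ι₁ z) = α₁ z := fun z =>
    DStrip.isoCast_eq (fun s => B₁.capsule (ι₁ s)) _ α₁ (ι₁.symm_apply_apply z)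
  refine ⟨{ indexEquiv := ι₁.symm.trans ((FlPM.toPerm l γ).trans ι₂)
            indexEquiv_charts := fun e he => ?_
            capsPoly := fun t =>
              DStrip.plusFullPolyIso ((s.symm.trans (α₁' t)).symm.trans (α₂ (γ • ι₁.symm t)))
            capsPoly_plusFull := fun t => ⟨_, rfl⟩
            globPoly := {ψ | ∃ c' ∈ K.autCsp B₂.glob, ψ = (β₁.symm ≪≫ b ≪≫ β₂) ≪≫ c'}
            globPoly_orbit := ⟨_, rfl⟩
            compat := fun t v => ?_ }, rfl⟩
  · rw [Equiv.trans_assoc, Equiv.trans_assoc]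
    refine B₁.torT.symm_trans_mem_of_compat hι₁ ?_
    obtain ⟨g, hg⟩ := hι₂ e he
    refine ⟨g * γ, ?_⟩
    show FlPM.toPerm l (g * γ) = (FlPM.toPerm l γ).trans (ι₂.trans e)
    rw [map_mul, Equiv.Perm.mul_def, show FlPM.toPerm l g = ι₂.trans e from hg]
  · obtain ⟨z, rfl⟩ := ι₁.surjective t
    change {h | ∃ p ∈ DStrip.plusFullPolyIso ((s.symm.trans (α₁' (ι₁ z))).symm.trans
        (α₂ (γ • ι₁.symm (ι₁ z)))), ∃ g ∈ B₂.poly (ι₂ (γ • ι₁.symm (ι₁ z))) v, h = (p v).hom ≫ g} =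
      {h | ∃ f ∈ B₁.poly (ι₁ z) v,
        ∃ q ∈ {ψ : B₁.glob ≅ B₂.glob | ∃ c' ∈ K.autCsp B₂.glob, ψ = (β₁.symm ≪≫ b ≪≫ β₂) ≪≫ c'},
          h = f ≫ (K.atV v).map (q : B₁.glob ≅ B₂.glob).hom}
    rw [hα₁', h₂, h₁, ellConj_capsule_side, ellConj_global_side_of_equivariant (α₁ z) β₁ β₂ z v hE hb hs,
      Equiv.symm_apply_apply]

/-- **[IUTchI] Prop 6.6 (ii), surjectivity — PROVED conditionally** on the equivariance of Example 6.3 (ii)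
for negative elements: every isomorphism of `𝔽_l^±`-torsors between the index sets is induced by an
isomorphism of `𝒟-Θ^{ell}`-bridges. [claim: Mochizuki2012, status: disputed] -/
theorem isoTorsor_surjective_of_equivariant (hE : ∀ γ : FlPM l, γ.IsNegative → Ex63.Equivariant K γ)
    (B₁ B₂ : K.DThetaEllBridge) :
    Function.Surjective fun g : Iso B₁ B₂ =>
      (⟨g.indexEquiv, g.indexEquiv_charts⟩ : {ι : B₁.T ≃ B₂.T // B₁.torT.Compat B₂.torT ι}) := by
  rintro ⟨κ, hκ⟩
  obtain ⟨ι₁, hι₁, α₁, β₁, h₁⟩ := B₁.exists_model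
  obtain ⟨ι₂, hι₂, α₂, β₂, h₂⟩ := B₂.exists_model
  -- `κ` read in coordinates is an element `γ` of `𝔽_l^{⋊±}`
  have hκ₀ : ι₁.trans (κ.trans ι₂.symm) ∈ (FlPMTorsor.tautological l).charts := by
    have h := hι₁ _ (hκ _ (B₂.torT.symm_trans_mem_of_compat hι₂ (e₀ := Equiv.refl _) ⟨1, by
      show FlPM.toPerm l 1 = _; rw [map_one]; rfl⟩))
    simpa only [Equiv.trans_refl] using h
  obtain ⟨γ, hγ⟩ := hκ₀
  have hκeq : κ = ι₁.symm.trans ((FlPM.toPerm l γ).trans ι₂) := by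
    ext t
    have ht := congrArg (fun f : ZMod l ≃ ZMod l => ι₂ (f (ι₁.symm t))) hγ
    simpa using ht.symm
  have hEγ : Ex63.Equivariant K γ := by
    rcases FlPM.isPositive_or_isNegative γ with h | h
    · exact Ex63.equivariant_of_isPositive h
    · exact hE γ h
  obtain ⟨g, hg⟩ := Iso.exists_of_equivariant B₁ B₂ hι₁ h₁ hι₂ h₂ γ hEγ
  exact ⟨g, Subtype.ext (hg.trans hκeq.symm)⟩

/-- **[IUTchI] Prop 6.6 (ii) — PROVED conditionally**: GIVEN the
equivariance of Example 6.3 (ii) for the negative elements of `𝔽_l^{⋊±}` (the `[−1]`-compatibility of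
`φ^{Θell}_{•,v}`, not carried by the interface), the named statement `DThetaEllBridge.IsoTorsor` holds:
isomorphisms of `𝒟-Θ^{ell}`-bridges form a torsor under (a group naturally outer-isomorphic to) `𝔽_l^{⋊±}`,
in bijection with the isomorphisms of `𝔽_l^±`-torsors of the index sets.
[claim: Mochizuki2012, status: disputed] -/
theorem isoTorsor_of_equivariant (hE : ∀ γ : FlPM l, γ.IsNegative → Ex63.Equivariant K γ)
    (B₁ B₂ : K.DThetaEllBridge) : IsoTorsor B₁ B₂ := fun hV =>
  ⟨isoTorsor_nonempty B₁ B₂, isoTorsor_injective hV B₁ B₂, isoTorsor_surjective_of_equivariant hE B₁ B₂⟩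

end DThetaEllBridge

/-! ### Proposition 6.8 (i), conditionally -/

namespace DThetaPMEllHT

/-- Over a base kit with a valuation, the index set of a `𝒟-Θ^{±ell}`-Hodge theater being FINITE and
`±`-label classes carrying negative automorphisms force `2 < l`. [claim: Mochizuki2012, status: disputed] -/
theorem two_lt_of_nonempty (hV : Nonempty K.V) (H : K.DThetaPMEllHT) : 2 < l := by
  obtain ⟨v⟩ := hV
  have h2 : (2 : ZMod l) ≠ 0 := two_ne_zero_of_isLocal (K.isLocal_model v)
  obtain ⟨ι, -⟩ := H.exists_model
  have hl0 : l ≠ 0 := by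
    rintro rfl
    haveI : Finite (ZMod 0) := Finite.of_equiv H.T ι.symm
    exact not_finite (ZMod 0)
  by_contra hle
  rw [not_lt] at hle
  interval_cases l
  · exact hl0 rfl
  · exact h2 (by decide)
  · exact h2 (by decide)

/-- **[IUTchI] Prop 6.8 (i), unconditional half of the count**: a `𝒟-Θ^{±ell}`-Hodge theater over a base
kit with a valuation has AT MOST `2·|T|` automorphisms of its underlying `𝒟-Θ^{ell}`-bridge (rigidity,
Prop 6.6 (ii) injectivity; equality is `EllBridgeSymmetry`, conditional on the negative equivariance).
[claim: Mochizuki2012, status: disputed] -/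
theorem card_ellBridgeIso_le (hV : Nonempty K.V) (H : K.DThetaPMEllHT) :
    Nat.card (DThetaEllBridge.Iso H.ellBridge H.ellBridge) ≤ 2 * Nat.card H.T := by
  have hl : 2 < l := two_lt_of_nonempty hV H
  obtain ⟨ι, -⟩ := H.exists_model
  have hcod : Nat.card {κ : H.T ≃ H.T // H.ellBridge.torT.Compat H.ellBridge.torT κ} = 2 * Nat.card H.T := by
    change Nat.card {f : H.T ≃ H.T // ∀ e' ∈ H.grpT.toTorsor.charts, f.trans e' ∈ H.grpT.toTorsor.charts} = _
    rw [H.grpT.toTorsor.card_isIso H.grpT.toTorsor hl, Nat.card_congr ι.symm, Nat.card_zmod]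
  haveI : Finite {κ : H.T ≃ H.T // H.ellBridge.torT.Compat H.ellBridge.torT κ} := by
    apply Nat.finite_of_card_ne_zero
    rw [hcod, Nat.card_congr ι.symm, Nat.card_zmod]
    omega
  rw [← hcod]
  exact Nat.card_le_card_of_injective _ (DThetaEllBridge.isoTorsor_injective hV _ _)

/-- **[IUTchI] Prop 6.8 (i) — PROVED conditionally** (equivariance of Example 6.3 (ii) for negative
elements): the automorphisms of the underlying `𝒟-Θ^{ell}`-bridge of a `𝒟-Θ^{±ell}`-Hodge theater act
transitively on `T` and there are exactly `2·|T|` of them — the named statement `EllBridgeSymmetry`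
("acts doubly transitively [i.e., transitively with stabilizers of order two]", p. 168).
[claim: Mochizuki2012, status: disputed] -/
theorem ellBridgeSymmetry_of_equivariant (hE : ∀ γ : FlPM l, γ.IsNegative → Ex63.Equivariant K γ)
    (H : K.DThetaPMEllHT) : EllBridgeSymmetry H := by
  refine fun hV => ⟨ellBridgeSymmetry_transitive H, ?_⟩
  have hl : 2 < l := two_lt_of_nonempty hV H
  have hbij : Function.Bijective fun g : DThetaEllBridge.Iso H.ellBridge H.ellBridge =>
      (⟨g.indexEquiv, g.indexEquiv_charts⟩ :
        {ι : H.T ≃ H.T // H.ellBridge.torT.Compat H.ellBridge.torT ι}) :=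
    ⟨DThetaEllBridge.isoTorsor_injective hV _ _, DThetaEllBridge.isoTorsor_surjective_of_equivariant hE _ _⟩
  rw [Nat.card_congr (Equiv.ofBijective _ hbij)]
  change Nat.card {f : H.T ≃ H.T // ∀ e' ∈ H.grpT.toTorsor.charts, f.trans e' ∈ H.grpT.toTorsor.charts} = _
  rw [H.grpT.toTorsor.card_isIso H.grpT.toTorsor hl]
  obtain ⟨ι, -⟩ := H.exists_model
  rw [Nat.card_congr ι.symm, Nat.card_zmod]

end DThetaPMEllHT

end PMBaseKit

end Literature.IUT.HodgeTheaters
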